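import Summits.QuantumFields.QCD.Theorems.PauliWegnerSeaFMClosureUnquenchedTwoStarC1
import Mathlib.Topology.Semicontinuity.Basic

/-!
# Crux `GaussianLinkFrames.FrameFMClosure` (stmt-QuantumFields-17375), line `pad-the-fibre`, stub
`stub_twoStarOfPadded` — helper 7: cofactor domination on SMALL tori by compactness (`SideWitness`)

On a torus of bounded side the padded recipe is not needed (and the pads wrap): for every `S ≤ S₀` the WHOLE torus
is a fibre of `≤ 4 (2S₀+1)⁴` links, and along it `‖adj (D_A ⊕ 1)_{ab}‖₁ ≤ C₀(S₀) · sup_W |det (D_A ⊕ 1)(W)|` for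
every admissible side `A`, all sites `a, b`, every probe mass `m₀ ∈ [-9,1]`, with ONE constant `C₀(S₀)`:
the adjugate block is bounded on the compact `(field, mass)`-space (joint continuity, `wilsonD` is affine in the
mass), and `m₀ ↦ sup_W |det (D_A ⊕ 1)(W, m₀)|` is lower semicontinuous and pointwise positive by `SideWitness`,
hence bounded below on `[-9,1]`; finitely many `(S, A, a, b)`.  This supplies the (sides) hypothesis of
`twoStarBounds_of_regionDomination` (helper 4) for `S ≤ S₀` with `R = univ`.

References: standard compactness [folklore]; `SideWitness` is `VonMisesCirclesC1.c1_sideWitness` (p120123).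
-/

noncomputable section

open scoped BigOperators
open Set
open Literature.MathematicalPhysics.QuantumFieldTheory Literature.MathematicalPhysics.QuantumLattice
  Literature.Probability.LatticeModels
open Summit.QuantumFields.QCD.Theorems.VonMisesCircles Summit.QuantumFields.QCD.Theorems.VonMisesCirclesC1

namespace Summit.QuantumFields.QCD.Theorems.PadTheFibreTwoStar

/-- `wilsonD` is affine in the bare mass: `D(W, m) = D(W, m') + (m - m') · 1`. [folklore] -/
theorem wilsonD_eq_add_smul_one {N : ℕ} [NeZero N] (W : GaugeConfig 4 N (Matrix.specialUnitaryGroup (Fin 3) ℂ))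
    (m m' : ℝ) : wilsonD W m = wilsonD W m' + ((m - m' : ℝ) : ℂ) • (1 : Matrix (QIdx N) (QIdx N) ℂ) := by
  ext p q
  simp only [wilsonD, wilsonDirac, Matrix.of_apply, Matrix.add_apply, Matrix.smul_apply, Matrix.one_apply,
    smul_eq_mul]
  split_ifs <;> push_cast <;> ring

/-- The side matrix `M_A ⊕ 1` depends continuously on `M`. [folklore] -/
theorem continuous_sideMatrix {N : ℕ} [NeZero N] (A : Finset (TorusSite 4 N)) :
    Continuous fun M : Matrix (QIdx N) (QIdx N) ℂ => sideMatrix A M := by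
  refine continuous_pi fun p => continuous_pi fun q => ?_
  simp only [sideMatrix, Matrix.of_apply]
  split_ifs
  · exact (continuous_apply q).comp (continuous_apply p)
  · exact continuous_const
  · exact continuous_const

/-- Joint continuity of `(W, m) ↦ D_A ⊕ 1`. [folklore] -/
theorem continuous_sideMatrix_wilsonD_uncurry {N : ℕ} [NeZero N] (A : Finset (TorusSite 4 N)) :
    Continuous fun p : GaugeConfig 4 N (Matrix.specialUnitaryGroup (Fin 3) ℂ) × ℝ => sideMatrix A (wilsonD p.1 p.2) := by
  have e : (fun p : GaugeConfig 4 N (Matrix.specialUnitaryGroup (Fin 3) ℂ) × ℝ => sideMatrix A (wilsonD p.1 p.2)) =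
      fun p => sideMatrix A (wilsonD p.1 0 + ((p.2 - 0 : ℝ) : ℂ) • (1 : Matrix (QIdx N) (QIdx N) ℂ)) := by
    funext p; rw [← wilsonD_eq_add_smul_one]
  rw [e]
  refine (continuous_sideMatrix A).comp ?_
  refine ((continuous_wilsonDirac (fundamentalRep (Fin 3)) (continuous_fundamentalRep (Fin 3)) 0 1).comp
    continuous_fst).add ?_
  exact (Complex.continuous_ofReal.comp (continuous_snd.sub continuous_const)).smul continuous_const

/-- **Domination on one small torus, one side, one block.**  For an admissible side `A` (so that `D_A ⊕ 1` is
invertible at some field for every probe mass, `SideWitness`) and sites `a, b`: one constant `C` with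
`‖adj (D_A ⊕ 1)_{ab}(W, m₀)‖₁ ≤ C · sup_{W'} |det (D_A ⊕ 1)(W', m₀)|` for all fields `W` and `m₀ ∈ [-9,1]`. [folklore] -/
theorem dom_fixed_of_sideWitness (hSW : SideWitness) {S : ℕ} (A : Finset (TorusSite 4 (2 * S + 1)))
    (hA : AdmissibleSide S A) (a b : TorusSite 4 (2 * S + 1)) :
    ∃ C : ℝ, 0 < C ∧ ∀ (m₀ : ℝ), -9 ≤ m₀ → m₀ ≤ 1 →
      ∀ W : GaugeConfig 4 (2 * S + 1) (Matrix.specialUnitaryGroup (Fin 3) ℂ),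
        blockNorm ((sideMatrix A (wilsonD W m₀)).adjugate) a b ≤
          C * ⨆ W' : GaugeConfig 4 (2 * S + 1) (Matrix.specialUnitaryGroup (Fin 3) ℂ),
            ‖(sideMatrix A (wilsonD W' m₀)).det‖ := by
  have hF := continuous_sideMatrix_wilsonD_uncurry (N := 2 * S + 1) A
  -- the adjugate block is bounded on (field) × [-9, 1]
  have hadjc : Continuous fun p : GaugeConfig 4 (2 * S + 1) (Matrix.specialUnitaryGroup (Fin 3) ℂ) × ℝ =>
      blockNorm ((sideMatrix A (wilsonD p.1 p.2)).adjugate) a b := by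
    unfold blockNorm
    refine continuous_finsetSum _ fun a' _ => continuous_finsetSum _ fun i _ =>
      continuous_finsetSum _ fun b' _ => continuous_finsetSum _ fun j _ => ?_
    exact (hF.matrix_adjugate.matrix_elem _ _).norm
  have hK : IsCompact ((univ : Set (GaugeConfig 4 (2 * S + 1) (Matrix.specialUnitaryGroup (Fin 3) ℂ))) ×ˢ Icc (-9 : ℝ) 1) :=
    isCompact_univ.prod isCompact_Icc
  obtain ⟨B, hB⟩ := hK.bddAbove_image hadjc.continuousOn
  have hBle : ∀ (W : GaugeConfig 4 (2 * S + 1) (Matrix.specialUnitaryGroup (Fin 3) ℂ)) (m₀ : ℝ), -9 ≤ m₀ → m₀ ≤ 1 →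
      blockNorm ((sideMatrix A (wilsonD W m₀)).adjugate) a b ≤ max B 0 := fun W m₀ h1 h2 =>
    (hB ⟨(W, m₀), ⟨mem_univ _, h1, h2⟩, rfl⟩).trans (le_max_left _ _)
  -- the determinant sup is lower semicontinuous in the mass and positive
  set g : ℝ → ℝ := fun m => ⨆ W' : GaugeConfig 4 (2 * S + 1) (Matrix.specialUnitaryGroup (Fin 3) ℂ),
    ‖(sideMatrix A (wilsonD W' m)).det‖ with hg
  have hdetc : ∀ W' : GaugeConfig 4 (2 * S + 1) (Matrix.specialUnitaryGroup (Fin 3) ℂ),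
      Continuous fun m : ℝ => ‖(sideMatrix A (wilsonD W' m)).det‖ := fun W' =>
    (hF.comp (Continuous.prodMk_right W')).matrix_det.norm
  have hbdd : ∀ m : ℝ, BddAbove (Set.range fun W' : GaugeConfig 4 (2 * S + 1) (Matrix.specialUnitaryGroup (Fin 3) ℂ) =>
      ‖(sideMatrix A (wilsonD W' m)).det‖) := fun m =>
    (isCompact_range ((continuous_sideMatrix_wilsonD A m).matrix_det.norm)).bddAbove
  have hlsc : LowerSemicontinuousOn g (Icc (-9 : ℝ) 1) :=
    (lowerSemicontinuous_ciSup hbdd fun W' => (hdetc W').lowerSemicontinuous).lowerSemicontinuousOn _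
  obtain ⟨mstar, hmstar, hmin⟩ := hlsc.exists_isMinOn (nonempty_Icc.2 (by norm_num)) isCompact_Icc
  obtain ⟨U₀, hU₀⟩ := hSW mstar hmstar.1 hmstar.2 S A hA
  have hgpos : 0 < g mstar :=
    lt_of_lt_of_le (norm_pos_iff.2 hU₀) (le_ciSup (hbdd mstar) U₀)
  have hgle : ∀ m₀ : ℝ, -9 ≤ m₀ → m₀ ≤ 1 → g mstar ≤ g m₀ := fun m₀ h1 h2 => hmin ⟨h1, h2⟩
  refine ⟨max B 0 / g mstar + 1, by positivity, fun m₀ h1 h2 W => ?_⟩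
  have hB0 : 0 ≤ max B 0 := le_max_right _ _
  calc blockNorm ((sideMatrix A (wilsonD W m₀)).adjugate) a b ≤ max B 0 := hBle W m₀ h1 h2
    _ = (max B 0 / g mstar) * g mstar := by field_simp
    _ ≤ (max B 0 / g mstar + 1) * g m₀ := by
        have h3 := hgle m₀ h1 h2
        have h4 : 0 ≤ max B 0 / g mstar := div_nonneg hB0 hgpos.le
        nlinarith

/-- **Domination on small tori** (`S ≤ S₀`): one constant `C₀(S₀)` such that for every `S ≤ S₀`, every admissible
side `A`, all `a, b`, every probe mass in `[-9,1]` and every field, along the fibre of ALL links (`R = univ`, the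
refit written as in the region hypotheses of helper 4) `‖adj (D_A ⊕ 1)_{ab}‖₁ ≤ C₀ sup_fibre |det (D_A ⊕ 1)|`.
[folklore] -/
theorem regionDom_small_of_sideWitness (hSW : SideWitness) (S₀ : ℕ) :
    ∃ C₀ : ℝ, 0 < C₀ ∧ ∀ (m₀ : ℝ), -9 ≤ m₀ → m₀ ≤ 1 → ∀ (S : ℕ), S ≤ S₀ →
      ∀ (A : Finset (TorusSite 4 (2 * S + 1))), AdmissibleSide S A → ∀ (a b : TorusSite 4 (2 * S + 1)),
      ∀ U W : GaugeConfig 4 (2 * S + 1) (Matrix.specialUnitaryGroup (Fin 3) ℂ),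
        blockNorm ((sideMatrix A (wilsonD
          (fun e => if e ∈ (Finset.univ : Finset (Edge 4 (2 * S + 1))) then W e else U e) m₀)).adjugate) a b ≤
          C₀ * ⨆ W' : GaugeConfig 4 (2 * S + 1) (Matrix.specialUnitaryGroup (Fin 3) ℂ),
            ‖(sideMatrix A (wilsonD
              (fun e => if e ∈ (Finset.univ : Finset (Edge 4 (2 * S + 1))) then W' e else U e) m₀)).det‖ := by
  classical
  -- one constant per torus
  have perS : ∀ S : ℕ, ∃ C : ℝ, 0 < C ∧ ∀ (m₀ : ℝ), -9 ≤ m₀ → m₀ ≤ 1 →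
      ∀ (A : Finset (TorusSite 4 (2 * S + 1))), AdmissibleSide S A → ∀ (a b : TorusSite 4 (2 * S + 1)),
      ∀ W : GaugeConfig 4 (2 * S + 1) (Matrix.specialUnitaryGroup (Fin 3) ℂ),
        blockNorm ((sideMatrix A (wilsonD W m₀)).adjugate) a b ≤
          C * ⨆ W' : GaugeConfig 4 (2 * S + 1) (Matrix.specialUnitaryGroup (Fin 3) ℂ),
            ‖(sideMatrix A (wilsonD W' m₀)).det‖ := by
    intro S
    have perA : ∀ (A : Finset (TorusSite 4 (2 * S + 1))) (a b : TorusSite 4 (2 * S + 1)),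
        ∃ C : ℝ, 0 < C ∧ (AdmissibleSide S A → ∀ (m₀ : ℝ), -9 ≤ m₀ → m₀ ≤ 1 →
          ∀ W : GaugeConfig 4 (2 * S + 1) (Matrix.specialUnitaryGroup (Fin 3) ℂ),
            blockNorm ((sideMatrix A (wilsonD W m₀)).adjugate) a b ≤
              C * ⨆ W' : GaugeConfig 4 (2 * S + 1) (Matrix.specialUnitaryGroup (Fin 3) ℂ),
                ‖(sideMatrix A (wilsonD W' m₀)).det‖) := by
      intro A a b
      by_cases hA : AdmissibleSide S A
      · obtain ⟨C, hC, h⟩ := dom_fixed_of_sideWitness hSW A hA a b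
        exact ⟨C, hC, fun _ => h⟩
      · exact ⟨1, one_pos, fun h => (hA h).elim⟩
    choose C hCpos hC using perA
    have hsup0 : ∀ (A : Finset (TorusSite 4 (2 * S + 1))) (m₀ : ℝ),
        0 ≤ ⨆ W' : GaugeConfig 4 (2 * S + 1) (Matrix.specialUnitaryGroup (Fin 3) ℂ),
          ‖(sideMatrix A (wilsonD W' m₀)).det‖ := fun A m₀ => Real.iSup_nonneg fun _ => norm_nonneg _
    refine ⟨∑ A : Finset (TorusSite 4 (2 * S + 1)), ∑ a : TorusSite 4 (2 * S + 1), ∑ b : TorusSite 4 (2 * S + 1),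
      C A a b, ?_, ?_⟩
    · exact Finset.sum_pos (fun A _ => Finset.sum_pos (fun a _ => Finset.sum_pos (fun b _ => hCpos A a b)
        Finset.univ_nonempty) Finset.univ_nonempty) Finset.univ_nonempty
    · intro m₀ h1 h2 A hA a b W
      refine (hC A a b hA m₀ h1 h2 W).trans (mul_le_mul_of_nonneg_right ?_ (hsup0 A m₀))
      have h3 : C A a b ≤ ∑ b' : TorusSite 4 (2 * S + 1), C A a b' :=
        Finset.single_le_sum (f := fun b' => C A a b') (fun b' _ => (hCpos A a b').le) (Finset.mem_univ b)
      have h4 : ∑ b' : TorusSite 4 (2 * S + 1), C A a b' ≤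
          ∑ a' : TorusSite 4 (2 * S + 1), ∑ b' : TorusSite 4 (2 * S + 1), C A a' b' :=
        Finset.single_le_sum (f := fun a' => ∑ b' : TorusSite 4 (2 * S + 1), C A a' b')
          (fun a' _ => Finset.sum_nonneg fun b' _ => (hCpos A a' b').le) (Finset.mem_univ a)
      have h5 : ∑ a' : TorusSite 4 (2 * S + 1), ∑ b' : TorusSite 4 (2 * S + 1), C A a' b' ≤
          ∑ A' : Finset (TorusSite 4 (2 * S + 1)), ∑ a' : TorusSite 4 (2 * S + 1),
            ∑ b' : TorusSite 4 (2 * S + 1), C A' a' b' :=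
        Finset.single_le_sum (f := fun A' => ∑ a' : TorusSite 4 (2 * S + 1), ∑ b' : TorusSite 4 (2 * S + 1), C A' a' b')
          (fun A' _ => Finset.sum_nonneg fun a' _ => Finset.sum_nonneg fun b' _ => (hCpos A' a' b').le)
          (Finset.mem_univ A)
      linarith
  choose C hCpos hC using perS
  refine ⟨∑ S ∈ Finset.range (S₀ + 1), C S, Finset.sum_pos (fun S _ => hCpos S) ⟨0, by simp⟩, ?_⟩
  intro m₀ h1 h2 S hS A hA a b U W
  simp only [Finset.mem_univ, if_true]
  refine (hC S m₀ h1 h2 A hA a b W).trans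
    (mul_le_mul_of_nonneg_right ?_ (Real.iSup_nonneg fun _ => norm_nonneg _))
  exact Finset.single_le_sum (f := C) (fun S' _ => (hCpos S').le) (Finset.mem_range.2 (by omega))

/-- **Registered helper `stub_twoStarOfPadded_aux7` of crux stmt-QuantumFields-17375** (line `pad-the-fibre`, stub
`stub_twoStarOfPadded`): cofactor domination along the full fibre on tori of side `≤ 2S₀+1`, all admissible sides,
uniformly in the probe mass `∈ [-9,1]`, from `SideWitness` by compactness — the small-torus half of the (sides)
hypothesis of the region-wise two-star package. [folklore] -/
theorem stub_twoStarOfPadded_aux7 : SideWitness → ∀ (S₀ : ℕ), ∃ C₀ : ℝ, 0 < C₀ ∧ ∀ (m₀ : ℝ), -9 ≤ m₀ → m₀ ≤ 1 → ∀ (S : ℕ), S ≤ S₀ → ∀ (A : Finset (TorusSite 4 (2 * S + 1))), AdmissibleSide S A → ∀ (a b : TorusSite 4 (2 * S + 1)), ∀ U W : GaugeConfig 4 (2 * S + 1) (Matrix.specialUnitaryGroup (Fin 3) ℂ), blockNorm ((sideMatrix A (wilsonD (fun e => if e ∈ (Finset.univ : Finset (Edge 4 (2 * S + 1))) then W e else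 U e) m₀)).adjugate) a b ≤ C₀ * ⨆ W' : GaugeConfig 4 (2 * S + 1) (Matrix.specialUnitaryGroup (Fin 3) ℂ), ‖(sideMatrix A (wilsonD (fun e => if e ∈ (Finset.univ : Finset (Edge 4 (2 * S + 1))) then W' e else U e) m₀)).det‖ :=
  fun hSW S₀ => regionDom_small_of_sideWitness hSW S₀

end Summit.QuantumFields.QCD.Theorems.PadTheFibreTwoStar
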